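import Literature.AnabelianGeometry.EtaleTheta.SettingModelChiCusp
import Literature.AnabelianGeometry.EtaleTheta.ThetaCoversModelPiC
import HarnessLib

/-!
# The χ-twisted model WITH a cusp (`curveχ′`): the synthetic cusp inertia does NOT generate `Δ̄_Θ` —
# kernel certificate that the §1-side clause of «`I_x ⥲ Δ̄_Θ`» FAILS there (census input, G-L2t10-3)

S. Mochizuki, *The étale theta function and its Frobenioid-theoretic manifestations*, Publ. RIMS **45**
(2009) [EtTh], §2, discussion preceding Def. 2.1, p. 35 (printed 261): «`D_x → Π^Θ_X` … maps the inertia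
group `I_x ⊆ D_x` isomorphically onto `Δ̄_Θ`», `Δ̄_Θ = [Δ̄_X, Δ̄_X]`; and [SemiAnbd] §6 p. 71 «`I_x` is
isomorphic to `Ẑ(1)` if `x` is a cusp» [cite: MochizukiEtTh2009, Def 2.1 p.35].

Cell abc-iut, layer L2, seat abc-iut-L2-t10 (gen 5; abc-iut-L2-lead R200 «KERNEL CERTIFICATE at curveχ′» for
the 13:00Z v-next census). The binder `hIx` of `ThetaSetting.PiCData.coverDataAx` was REDUCED
(`Discharge/Sec2InertiaBinderOfHat`, p432830; GAP-LEDGER G-L2t10-3) to the §1-side clause — for a compact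
decomposition group — `toHat(I_x) ⊔ barKerHat l = barThetaHat l` in `Π_X`, where by `rfl`
`barKerHat/barThetaHat = ClassTwoBar.barKerOf/barThetaOf Δ_X l`. abc-iut-w5-d029's cusp datum
`SettingModel.curveχ′ p` (R130, `SettingModelChiCusp`: `Π^tp_X = Γ ⋊_χ G_{ℚ_p}`, `D_x = b^Ẑ ⋊ G_{ℚ_p}`,
`I_x = inl(b^Ẑ)` — HONESTLY LABELLED there as «synthetic: the TORAL `b`-axis, not print's commutator axis»)
is the ONLY `TemperedCurve` in the tree with a cusp. This PROOF-ONLY file (0 definitions) certifies in the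
kernel what that label says:

* §1 a generic closure lemma `ClassTwoBar.barThetaOf_le_of_isClosed` (a closed subgroup containing
  `[Δ,Δ]` and the `l`-th powers of a normal `Δ` contains `barThetaOf Δ l`) and the multiplicativity of
  `left` on `Δ_X = F̂₂ ⋊ 1 = Ker(Π_X → G_{ℚ_p})` of the χ-model;
* §2 **`inl_eta_one_not_mem_barThetaOf`**: `b = inl(η b) ∉ barThetaOf Δ_X l` for `l ≥ 2` — the
  `b`-exponent modulo `l`, `Δ_X → F̂₂ → Ẑ → ℤ/l` (abc-iut-w5-d029's `eHatB`, the tree's `ZHatLevel.level`),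
  kills commutators and `l`-th powers and has CLOSED kernel, but takes the value `1 ≢ 0` on `b`;
* §3 **`not_inertiaClause_curveχ'`**: for every `l ≥ 2` and the cusp `x` of `curveχ′`,
  `¬ (toHat(I_x) ⊔ barKerOf Δ_X l = barThetaOf Δ_X l)` (indeed `toHat(I_x) ≰ barThetaOf Δ_X l`, as
  `b ∈ toHat(I_x)`), also in the closure form; `exists_cusp_inertiaClause_fails` packages it with the
  clauses the datum DOES satisfy (a cusp exists, `I_x ≅ Ẑ`).

READING (numbers, not adjectives): the per-`l` clause «inertia generates `Δ̄_Θ` mod `Ker(Δ_X ↠ Δ̄_X)`» is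
REFUTED at the only cusp datum of the tree for every `l ≥ 2`; the free-basis form «`toHat(I_x) = ⟨[a,b]⟩⁻`
for a topological generating pair» implies the per-`l` form and is therefore refuted there as well — the
position of `I_x` in `Δ_X` is NOT determined by the `TemperedCurve` interface. Both forms remain
genuine-models-only ORIGIN CLAUSES; a synthetic model is consistency evidence only and this certificate does
not bear on [EtTh] (whose cusp inertia IS the commutator axis). No new `Prop` fact, no definition; zero edit
of any other seat's file; no side is taken on [IUTchIII] Cor. 3.12; typed ≠ proved.
-/

noncomputable section

namespace Literature.AnabelianGeometry.EtaleTheta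

open scoped commutatorElement
open Literature.AnabelianGeometry.SemiGraphs _root_.Topology _root_.Function

/-! ## §1. Generic: closed subgroups containing `[Δ,Δ]·Δ^l` contain the `Δ̄_Θ`-preimage -/

namespace ClassTwoBar

variable {G : Type*} [Group G] [TopologicalSpace G] [IsTopologicalGroup G] (Δ : Subgroup G) (l : ℕ)

/-- A CLOSED subgroup `K` containing `[Δ, Δ]` and the `l`-th powers of a normal subgroup `Δ` contains
`barThetaOf Δ l` (the closure of `[Δ,Δ] · ⟨Δ^l⟩^normal`, the `Δ̄_Θ`-preimage recipe of Def. 2.1 p. 35).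
[cite: MochizukiEtTh2009, Def 2.1 p.35] -/
theorem barThetaOf_le_of_isClosed (hΔ : Δ.Normal) {K : Subgroup G} (hK : IsClosed (K : Set G))
    (h1 : ⁅Δ, Δ⁆ ≤ K) (h2 : ∀ y ∈ Δ, y ^ l ∈ K) : barThetaOf Δ l ≤ K := by
  refine Subgroup.topologicalClosure_minimal _ (sup_le h1 ?_) hK
  rw [normalClosure_powSet_eq Δ l hΔ, Subgroup.closure_le]
  rintro _ ⟨y, hy, rfl⟩
  exact h2 y hy

end ClassTwoBar

namespace SettingModel

open ClassTwoBar

variable (p : ℕ) [Fact p.Prime]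

/-- On `Δ_X = Ker(right)` of the χ-model the first projection is multiplicative:
`(g h).left = g.left · h.left` when `g.right = 1`. [cite: MochizukiEtTh2009, §1 p.12] -/
theorem left_mul_of_right_eq_one {g : PiHtχ p} (hg : g.right = 1) (h : PiHtχ p) :
    (g * h).left = g.left * h.left := by
  rw [SemidirectProduct.mul_left, hg, map_one, MulAut.one_apply]

/-! ## §2. `b ∉ barThetaOf Δ_X l` for `l ≥ 2`: the `b`-exponent modulo `l` -/

/-- **`b = inl(η b)` is NOT in the `Δ̄_Θ`-preimage `barThetaOf Δ_X l` of the χ-model, for `l ≥ 2`.** The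
`b`-exponent modulo `l`, `ψ : Δ_X → F̂₂ → Ẑ → ℤ/l` (`g ↦ level_l (ê_b (g.left))`), is a homomorphism into an
abelian group of exponent `l`, so its kernel contains `[Δ_X,Δ_X]` and `Δ_X^l`; the kernel is
`Δ_X ∩ left⁻¹(ê_b⁻¹(Ker level_l))`, closed (`left`, `ê_b` continuous; `Ker(Ẑ → ℤ/l)` open hence closed);
so `barThetaOf Δ_X l ⊆ Ker ψ`, while `ψ(b) = 1 mod l ≠ 0`. [cite: MochizukiEtTh2009, Def 2.1 p.35] -/
theorem inl_eta_one_not_mem_barThetaOf (l : ℕ) (hl : 2 ≤ l) :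
    (SemidirectProduct.inl (eta (FreeGroup.of 1)) : PiHtχ p) ∉ barThetaOf (curveχ p).DeltaHat l := by
  intro hb
  have hl' : 0 < l := by omega
  let L : ℕ+ := ⟨l, hl'⟩
  -- the `b`-exponent modulo `l` on the subgroup `Δ_X`
  let φ : (curveχ p).DeltaHat →* F₂hatT :=
    { toFun := fun g => (g : PiHtχ p).left
      map_one' := SemidirectProduct.one_left
      map_mul' := fun g h => left_mul_of_right_eq_one p (right_eq_one_of_mem_deltaHatχ p g.2) h }
  let ψ : (curveχ p).DeltaHat →* Multiplicative (ZMod L) :=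
    (ZHatLevel.level L).comp (eHatB.toMonoidHom.comp φ)
  have hψ : ∀ g : (curveχ p).DeltaHat, ψ g = ZHatLevel.level L (eHatB (g : PiHtχ p).left) := fun _ => rfl
  -- its kernel, pushed into `Π_X`
  let K : Subgroup (PiHtχ p) := ψ.ker.map (curveχ p).DeltaHat.subtype
  have hmem : ∀ g : PiHtχ p, g ∈ K ↔ g ∈ (curveχ p).DeltaHat ∧ ZHatLevel.level L (eHatB g.left) = 1 := by
    intro g
    constructor
    · rintro ⟨g', hg', rfl⟩
      exact ⟨g'.2, hg'⟩
    · rintro ⟨hg, h⟩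
      exact ⟨⟨g, hg⟩, h, rfl⟩
  -- `K` is closed
  have hK : IsClosed (K : Set (PiHtχ p)) := by
    have hset : (K : Set (PiHtχ p)) = ((curveχ p).DeltaHat : Set (PiHtχ p)) ∩
        (fun g : PiHtχ p => eHatB g.left) ⁻¹' ((ZHatLevel.level L).ker : Set ZH) := by
      ext g
      rw [SetLike.mem_coe, hmem, Set.mem_inter_iff, Set.mem_preimage, SetLike.mem_coe, SetLike.mem_coe,
        MonoidHom.mem_ker]
    rw [hset]
    refine (Subgroup.isClosed_topologicalClosure _).inter (IsClosed.preimage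
      (eHatB.continuous.comp (Semidirect.continuous_left (isInducing_leftRightHatχ p))) ?_)
    exact Subgroup.isClosed_of_isOpen _ (ZHatLevel.isOpen_ker_level L)
  -- `K` contains the commutators and the `l`-th powers of `Δ_X`
  have h1 : ⁅(curveχ p).DeltaHat, (curveχ p).DeltaHat⁆ ≤ K := by
    refine Subgroup.commutator_le.mpr fun u hu v hv => ?_
    refine ⟨⁅(⟨u, hu⟩ : (curveχ p).DeltaHat), ⟨v, hv⟩⁆, ?_, rfl⟩
    rw [SetLike.mem_coe, MonoidHom.mem_ker, map_commutatorElement, commutatorElement_eq_one_iff_commute]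
    exact Commute.all _ _
  have h2 : ∀ y ∈ (curveχ p).DeltaHat, y ^ l ∈ K := by
    intro y hy
    refine ⟨(⟨y, hy⟩ : (curveχ p).DeltaHat) ^ l, ?_, rfl⟩
    rw [SetLike.mem_coe, MonoidHom.mem_ker, map_pow]
    generalize ψ ⟨y, hy⟩ = z
    rw [← ofAdd_toAdd z, ← ofAdd_nsmul, nsmul_eq_mul, show ((l : ℕ) : ZMod L) = 0 from ZMod.natCast_self L,
      zero_mul, ofAdd_zero]
  -- hence `barThetaOf Δ_X l ≤ K`, so `b ∈ K`: its `b`-exponent `1` vanishes modulo `l ≥ 2` — absurd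
  have hbK := (barThetaOf_le_of_isClosed _ l (deltaHatχ_normal p) hK h1 h2) hb
  obtain ⟨-, h⟩ := (hmem _).1 hbK
  rw [SemidirectProduct.left_inl, eHatB_eta, expB_of_one, iotaZ_one_eq, ZHatLevel.level_eta] at h
  haveI : Nontrivial (ZMod (L : ℕ)) := ZMod.nontrivial_iff.mpr (show l ≠ 1 by omega)
  have h1' : ((1 : ℤ) : ZMod (L : ℕ)) = 0 := Multiplicative.ofAdd.injective (h.trans ofAdd_zero.symm)
  rw [Int.cast_one] at h1'
  exact one_ne_zero h1'

/-! ## §3. The synthetic inertia `b^Ẑ` is not carried onto `Δ̄_Θ` -/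

/-- The element `b = inl(η b) ∈ Π_X` lies in `toHat(I_x)` for the cusp `x` of `curveχ′` (`I_x = inl(b^Ẑ)`,
`toHat ∘ inl = inl ∘ pr₁`, `b^{ι(1)} = η b`). [cite: MochizukiSemiAnbd2006, §6 p.71] -/
theorem inl_eta_one_mem_map_inertia (x : (curveχ' p).Pt) :
    (SemidirectProduct.inl (eta (FreeGroup.of 1)) : PiHtχ p) ∈
      ((curveχ' p).inertia x).map (curveχ' p).toHat.toMonoidHom := by
  rw [inertia_curveχ'_eq]
  refine ⟨SemidirectProduct.inl (bPowGfp (iotaZ (Multiplicative.ofAdd 1))), ⟨_, bPowGfp_mem_bAxisGfp _, rfl⟩, ?_⟩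
  change toHatχ p (SemidirectProduct.inl (bPowGfp (iotaZ (Multiplicative.ofAdd 1)))) = _
  refine SemidirectProduct.ext ?_ rfl
  rw [toHatχ_left, SemidirectProduct.left_inl, SemidirectProduct.left_inl, gfpFst_apply, coe_bPowGfp,
    bPow_iotaZ_one]

/-- **The synthetic inertia is not inside the `Δ̄_Θ`-preimage**: `toHat(I_x) ≰ barThetaOf Δ_X l` for the cusp
of `curveχ′` and every `l ≥ 2` (the `b`-axis maps NON-trivially to `Δ̄^ell_X`).
[cite: MochizukiEtTh2009, Def 2.1 p.35] -/
theorem not_map_inertia_le_barThetaOf_curveχ' (l : ℕ) (hl : 2 ≤ l) (x : (curveχ' p).Pt) :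
    ¬ ((curveχ' p).inertia x).map (curveχ' p).toHat.toMonoidHom ≤ barThetaOf (curveχ' p).DeltaHat l := by
  intro h
  rw [curveχ'_deltaHat] at h
  exact inl_eta_one_not_mem_barThetaOf p l hl (h (inl_eta_one_mem_map_inertia p x))

/-- **KERNEL CERTIFICATE (abc-iut-L2-lead R200, census input for G-L2t10-3).** At the only cusp datum of
the tree, abc-iut-w5-d029's `curveχ′` (synthetic toral inertia `b^Ẑ`), the §1-side clause of «`I_x ⥲ Δ̄_Θ`»
— `toHat(I_x) ⊔ barKerOf Δ_X l = barThetaOf Δ_X l`, the reduced form of the binder `hIx` of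
`PiCData.coverDataAx` (`Sec2InertiaBinderOfHat`) — is FALSE for every `l ≥ 2`.
[cite: MochizukiEtTh2009, Def 2.1 p.35] -/
theorem not_inertiaClause_curveχ' (l : ℕ) (hl : 2 ≤ l) (x : (curveχ' p).Pt) :
    ¬ (((curveχ' p).inertia x).map (curveχ' p).toHat.toMonoidHom ⊔ barKerOf (curveχ' p).DeltaHat l =
        barThetaOf (curveχ' p).DeltaHat l) := by
  intro h
  exact not_map_inertia_le_barThetaOf_curveχ' p l hl x (le_sup_left.trans h.le)

/-- The same with the closure of `toHat(I_x)` (the non-compact form of the §1-side clause).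
[cite: MochizukiEtTh2009, Def 2.1 p.35] -/
theorem not_inertiaClause_closure_curveχ' (l : ℕ) (hl : 2 ≤ l) (x : (curveχ' p).Pt) :
    ¬ ((((curveχ' p).inertia x).map (curveχ' p).toHat.toMonoidHom).topologicalClosure ⊔
          barKerOf (curveχ' p).DeltaHat l = barThetaOf (curveχ' p).DeltaHat l) := by
  intro h
  exact not_map_inertia_le_barThetaOf_curveχ' p l hl x
    ((Subgroup.le_topologicalClosure _).trans (le_sup_left.trans h.le))

/-- Census summary: at `curveχ′` the cusp EXISTS and its inertia is `≅ Ẑ` (the typed clause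
`inertia_equiv_zHat` holds), yet for every `l ≥ 2` the inertia does NOT generate `Δ̄_Θ` modulo
`Ker(Δ_X ↠ Δ̄_X)` — the position of the inertia in `Δ_X` is not determined by the `TemperedCurve` interface.
[cite: MochizukiEtTh2009, Def 2.1 p.35] -/
theorem exists_cusp_inertiaClause_fails (l : ℕ) (hl : 2 ≤ l) :
    ∃ x : (curveχ' p).Pt, (curveχ' p).IsCusp x ∧
      Nonempty (↥((curveχ' p).decomp x ⊓ (curveχ' p).aug.toMonoidHom.ker) ≃ₜ* ZHat) ∧
      ¬ (((curveχ' p).inertia x).map (curveχ' p).toHat.toMonoidHom ⊔ barKerOf (curveχ' p).DeltaHat l =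
          barThetaOf (curveχ' p).DeltaHat l) :=
  ⟨(), trivial, (curveχ' p).inertia_equiv_zHat () trivial, not_inertiaClause_curveχ' p l hl ()⟩

end SettingModel

end Literature.AnabelianGeometry.EtaleTheta

end
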